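import Summits.CriticalPhenomena.PercolationContinuityZ3.Theses.PercFiniteBoxLRO
import Summits.CriticalPhenomena.PercolationContinuityZ3.Theorems.PercFiniteBoxLRORenormaliseFromLinearLROBlockDefs
import Summits.CriticalPhenomena.PercolationContinuityZ3.Theorems.PercFiniteBoxLRORenormaliseFromLinearLRODefs
import Summits.CriticalPhenomena.PercolationContinuityZ3.Theorems.PercFiniteBoxLRORenormaliseFromLinearLROStubBlockLawInputs
import Summits.CriticalPhenomena.PercolationContinuityZ3.Theorems.PercFiniteBoxLRORenormaliseFromLinearLROStubDenseGlue
import Summits.CriticalPhenomena.PercolationContinuityZ3.Theorems.PercFiniteBoxLRORenormaliseFromLinearLROStubLargeCountMoments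
import Summits.CriticalPhenomena.PercolationContinuityZ3.Theorems.PercFiniteBoxLRORenormaliseFromLinearLROStubNoLROK1
import Summits.CriticalPhenomena.PercolationContinuityZ3.Theorems.PercFiniteBoxLRORenormaliseFromLinearLROStubDenseMarkovPointwise
import Summits.CriticalPhenomena.PercolationContinuityZ3.Theorems.PercFiniteBoxLRORenormaliseFromLinearLROStubDenseMarkov
import Summits.CriticalPhenomena.PercolationContinuityZ3.Theorems.PercFiniteBoxLRORenormaliseFromLinearLRODenseCriterion
import Summits.CriticalPhenomena.PercolationContinuityZ3.Theorems.PercFiniteBoxLRORenormaliseFromLinearLROSpineDefs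
import Summits.CriticalPhenomena.PercolationContinuityZ3.Theorems.PercFiniteBoxLRORenormaliseFromLinearLROStubSpineGlue
import Summits.CriticalPhenomena.PercolationContinuityZ3.Theorems.PercFiniteBoxLRORenormaliseFromLinearLROStubSpineFailure
import Summits.CriticalPhenomena.PercolationContinuityZ3.Theorems.PercFiniteBoxLRORenormaliseFromLinearLROSpineCriterion
import Summits.CriticalPhenomena.PercolationContinuityZ3.Theorems.PercFiniteBoxLRORenormaliseFromLinearLROLinearTwoArms
import Summits.CriticalPhenomena.PercolationContinuityZ3.Theorems.PercFiniteBoxLRORenormaliseFromLinearLROTwoArmsFrontier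
import Summits.CriticalPhenomena.PercolationContinuityZ3.Theorems.PercFiniteBoxLRORenormaliseFromLinearLROAnatomy
import Summits.CriticalPhenomena.PercolationContinuityZ3.Theorems.PercFiniteBoxLRORenormaliseFromLinearLRONoGoodBoxAtPc
import Literature.Probability.Percolation.SlabCriticalityInputs
import Literature.Probability.Percolation.ConnectivityProofs
import Literature.Probability.Percolation.SharpnessDCTProofs
import Literature.Probability.Percolation.UniformPercolation
import Literature.Probability.Percolation.CriticalContinuityProofs

/-!
# `Lines/registered.lean` — skeleton of line `registered` for crux `PercFiniteBoxLRO.RenormaliseFromLinearLRO`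
(item stmt-CriticalPhenomena-0857 · route route-CriticalPhenomena-PercFiniteBoxLRO · rank 3 ·
sub-problem `PercolationContinuityZ3` · lead prover-line-stmt-CriticalPhenomena-0857-c1-0, 2026-08-17;
RESHAPE 2 of `Lines/birth.lean`)

**Crux R.** `RenormaliseFromLinearLRO`: `∀ p, LRO_lin(p) → ∃ p' < p, 0 < θ_{ℤ³}(p')`, where
`LRO_lin(p) := ∃ ρ > 0, ∃ K, ∀ n ≥ 1, ∀ x y ∈ Λ(n), ρ ≤ P_p(x ↔ y inside Λ(Kn))`.
LANDED ANATOMY (reshape 1, p152652): `R ⇔ ¬LRO_lin(p_c)` (`stub_cruxIffNotLinearLROAtPc`).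

**Reshape 2 (same composition idea as `birth`/reshape 1: same-`p` boost + same-`p` finite-size
criterion + continuity of ONE box polynomial; what changed and why).**
1. The block event changes from Grimmett's good box `G_n` (crossing cluster + in-box UNIQUENESS) to the
   DENSE block `denseBox K s m` (objects file `…BlockDefs.lean`): some base point is joined inside
   `Λ(K n)`, `n = (2s+1)m`, to a strict majority of the locally-large grid points (one-arm to distance `s`)
   of each of the four overlap halves of the core `Λ(n)`.  Dense neighbouring blocks glue by PIGEONHOLE
   (two strict majorities of one finite set meet) — no uniqueness clause, no crossing geometry — so the
   same-`p` criterion (`denseCriterion`, proved here from the generic block stubs + DST dependent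
   percolation, PROVED in the tree) consumes a block event whose failure is an AVERAGED two-cluster event.
2. The open content shrinks accordingly: `stub_critDense` — `LRO_lin(p_c)` with `K ≥ 2` ⇒ a dense block
   w.h.p. at some scale (for the criterion's `δ`-schedule) — averaged local uniqueness, the weakest form of
   the Kozma–Nitzan / DKT Example 1 difficulty.  It is PROVED here in the NEAR-MAXIMAL regime
   `ρ ≥ (1 − η₀(K))·θ(p_c)²` (`not_nearMaximal_linearLRO_criticalProbI`, from the second-moment stub
   `stub_denseMarkov`): an unconditional special case of the crux.
3. The boundary case `K = 1` (connections inside `Λ(n)` itself, i.e. up to the faces) is a separate stub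
   `stub_noLRO_K1`, refuted outright by Barsky–Grimmett–Newman `θ_ℍ(p_c) = 0` (PROVED in the tree,
   `BarskyGrimmettNewman1991_Z3_holds`, via `BoxGatewayRarity`); `K = 0` is vacuous.

**Status at the end of lead cycle 2 (2026-08-17).**  LANDED (all `--supports` this item): reshape 2 — p156138 BlockDefs
(+`stub_denseLocal`), p157445 `stub_blockLawInputs`, p158137 `stub_denseGlue`, p158461 `stub_largeCountMoments`,
p158904 `stub_noLRO_K1` (the case `K = 1` REFUTED by Barsky–Grimmett–Newman), p159526 `stub_denseMarkovPointwise`,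
p160841 `stub_denseMarkov`, p161630 DenseCriterion (`denseCriterion`, `stub_noDenseBoxAtPc`, `lro_le_theta_sq`: the LRO
constant is `≤ θ(p)²`, `stub_noNearMaximalLRO`); reshape 3 — p162413 SpineDefs (+`stub_spineLocal`), p162811
`stub_spineGlue`, p163025 `stub_spineFailure`, p163218 SpineCriterion (`spineCriterion` with ONE threshold,
`stub_noSpineAtPc`, `stub_noNearMaximalLRO_inv`: **no `LRO_lin(p_c)` with `ρ ≥ (1 − c₀/K)·θ(p_c)²`, `c₀` absolute**,
`critSpine_of_critDense`, the composition), p163651 LinearTwoArms (`stub_lroForcesLinearTwoArms`: **`LRO_lin(p_c)`,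
`K ≥ 2`, FORCES the r5 box two-arms event at linear ratio `K` with probability `≥ c > 0` at all large scales**).
OPEN: the one `sorry` of this file, `stub_critSpine` — averaged local uniqueness at ONE scale w.h.p. under `LRO_lin(p_c)`
(the Kozma–Nitzan / DKT Ex. 1 difficulty in its weakest form); the crux follows from it by `RenormaliseFromLinearLRO_of`.

**Lead cycle 3 (lead c2, 2026-08-17) — the TWO-ARMS FRONTIER of the line, LANDED** (p167450,
`…TwoArmsFrontier.lean`, registered sub-goals `stub_twoArmsAllRatios`, `stub_thetaZeroOfLinearTwoArmsRate`): the proof of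
p163651 uses `LRO_lin(p_c)` only through `θ(p_c) > 0`, so UNCONDITIONALLY **`θ(p_c) > 0 ⇒ P_{p_c}(box two-arms at radii
(n, K·n)) ≥ c·θ(p_c)²/K` for EVERY `K ≥ 2`** (absolute `c`, all large special scales); contrapositively **a linear-scale
two-arms RATE `o(1/K)` (in the percolating world) gives `θ(p_c) = 0` — the conjunct itself — hence `¬LRO_lin(p_c)`, the
crux by name, and `stub_critSpine`** (§5: `conjunct_of_linearTwoArmsRate`, `crux_of_linearTwoArmsRate`,
`critSpine_of_linearTwoArmsRate`; a box two-arms exponent `> 1` at linear scale gives the rate).  So the same-`p` boost of this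
line (second moment over dense/spine blocks) closes the crux exactly when linear two-arms is `o(1/K)` in the LRO world, and
that much input is conjunct-strength (KozmaNitzan2024 §1 approach (5); VandenbergVanengelenburg2022 Prop. 2 is the
unconditional bound in the opposite direction with an LSS-sized `δ(M) ≪ 1/M`).

Registered stubs (reshape 2 list; plus S1–S3, D', T1, T2 below): `stub_blockLawInputs` (generic: dependence + density of the coarse law of ANY local
block event), `stub_denseGlue` (pigeonhole gluing, deterministic), `stub_denseLocal` (locality of the dense
block), `stub_largeCountMoments` (first two moments of the number of locally-large grid points),
`stub_denseMarkovPointwise` + `stub_denseMarkov` (second-moment bound: average in-box pair connectivity of grid points near `θ_s²` ⇒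
dense block likely), `stub_noLRO_K1` (BGN), `stub_critDense` (OPEN — the crux's residual content).

Layout: §0 the name-keyed stub statements `Sig.stub_*` · §1 the seven registered stubs
`theorem stub_* : <spelled-out signature>` · §2 glue proved here (dense criterion, continuity, the
near-maximal regime, `¬LRO_lin(p_c)` from the stubs) · §3 the composition `RenormaliseFromLinearLRO_of`
concluding the crux BY NAME · §4 definitional consistency.
-/

noncomputable section

namespace Summit.CriticalPhenomena.PercolationContinuityZ3.Cruxes.RenormaliseFromLinearLRO.Birth

open Literature.Probability.Percolation Literature.Probability.LatticeModels
open MeasureTheory Filter Topology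
open Summit.CriticalPhenomena.PercolationContinuityZ3.Theorems.RenormaliseFromLinearLRO

/-! ## §0 Name-keyed stub statements -/

namespace Sig

/-- Name-keyed statement of `stub_blockLawInputs`: for ANY measurable block event `E` determined by the
pairs inside `Λ(R)`, the coarse law `blockLaw n E p` (i) makes events of coarse edge sets at planar
sup-distance `≥ D` independent whenever `2R < D n`, and (ii) opens every lattice edge with probability
`≥ 2 P_p(E) − 1`. -/
def stub_blockLawInputs : Prop :=
  (∀ (p : unitInterval) (n R D : ℕ) (E : Set (BondConfig (Site 3))), 2 * R < D * n →
      MeasurableSet E → DeterminedBy E (↑((box 3 R).sym2) : Set (Sym2 (Site 3))) →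
      ∀ (F₁ F₂ : Finset (Sym2 (Site 2))),
        (∀ e₁ ∈ F₁, ∀ e₂ ∈ F₂, ∀ a ∈ e₁, ∀ b ∈ e₂, (D : ℤ) ≤ max |a 0 - b 0| |a 1 - b 1|) →
        ∀ (A B : Set (BondConfig (Site 2))), DeterminedBy A (↑F₁ : Set (Sym2 (Site 2))) →
          DeterminedBy B (↑F₂ : Set (Sym2 (Site 2))) → MeasurableSet A → MeasurableSet B →
          blockLaw n E p (A ∩ B) = blockLaw n E p A * blockLaw n E p B) ∧
  (∀ (p : unitInterval) (n : ℕ) (E : Set (BondConfig (Site 3))), MeasurableSet E →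
      ∀ e ∈ (zdGraph 2).edgeSet,
        2 * (bondPercolation (zdGraph 3) p).real E - 1 ≤ (blockLaw n E p).real {σ | e ∈ σ})

/-- Name-keyed statement of `stub_denseGlue`: an infinite coarse cluster of dense blocks carries an
infinite open cluster meeting `Λ(K n)` (pigeonhole gluing of neighbouring dense blocks; `m ≥ 1`, else all
block centres coincide — refuter-worker witness `K = s = m = 0`, `ω = ∅`). -/
def stub_denseGlue : Prop :=
  ∀ (K s m : ℕ), 1 ≤ m → ∀ (ω : BondConfig (Site 3)),
    blockCfg ((2 * s + 1) * m) (denseBox K s m) ω ∈ percolatesAt (0 : Site 2) →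
      ∃ x ∈ box 3 (K * ((2 * s + 1) * m)), ω ∈ percolatesAt x

/-- Name-keyed statement of `stub_denseLocal`: the dense block is determined by the pairs inside
`Λ(K n)` (`K ≥ 2`, `m ≥ 1`, so that the local one-arm events of the grid points live inside `Λ(K n)`). -/
def stub_denseLocal : Prop :=
  ∀ (K s m : ℕ), 2 ≤ K → 1 ≤ m →
    DeterminedBy (denseBox K s m) (↑((box 3 (K * ((2 * s + 1) * m))).sym2) : Set (Sym2 (Site 3)))

/-- Name-keyed statement of `stub_largeCountMoments`: first and second moment of the number of
locally-large points of a set of pairwise far (`≥ 2s+1` in some coordinate) points: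
`E[X] = |G| θ_s`, `E[X²] ≤ |G| θ_s + |G|² θ_s²`, `θ_s = P_p(0 ↔ ∂Λ(s))`. -/
def stub_largeCountMoments : Prop :=
  ∀ (p : unitInterval) (s : ℕ) (G : Finset (Site 3)),
    (∀ y ∈ G, ∀ y' ∈ G, y ≠ y' → ∃ i : Fin 3, ((2 * s + 1 : ℕ) : ℤ) ≤ |y i - y' i|) →
    (∫ ω, (largeCount s G ω : ℝ) ∂(bondPercolation (zdGraph 3) p) =
        G.card * (bondPercolation (zdGraph 3) p).real (siteToBoundary 3 s)) ∧
    (∫ ω, (largeCount s G ω : ℝ) ^ 2 ∂(bondPercolation (zdGraph 3) p) ≤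
        G.card * (bondPercolation (zdGraph 3) p).real (siteToBoundary 3 s) +
          (G.card : ℝ) ^ 2 * (bondPercolation (zdGraph 3) p).real (siteToBoundary 3 s) ^ 2)

/-- Name-keyed statement of `stub_denseMarkovPointwise` (the deterministic half of the second-moment
boost): (A) for a lattice configuration, `12·Y ≤ 12 g + 12 X² − 1_F X²` where `Y` counts the ordered pairs of
core grid points joined inside `Λ(Kn)`, `X` the locally-large core grid points, and `F` = "every base point is
joined to fewer than `11/12` of them"; (E) off the dense block, either `F` holds or some half-grid carries at
most a sixth of the locally-large core grid points. -/
def stub_denseMarkovPointwise : Prop :=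
  ∀ (K s m : ℕ) (ω : BondConfig (Site 3)),
    (ω ⊆ (zdGraph 3).edgeSet →
      12 * (∑ y ∈ coreGrid s m, ∑ y' ∈ coreGrid s m,
          (openConnIn (↑(box 3 (K * ((2 * s + 1) * m))) : Set (Site 3)) y y').indicator
            (fun _ => (1 : ℝ)) ω) ≤
        12 * ((coreGrid s m).card : ℝ) + 12 * (largeCount s (coreGrid s m) ω : ℝ) ^ 2 -
          {ω' : BondConfig (Site 3) | ∀ x : Site 3,
              12 * joinedCount s ↑(box 3 (K * ((2 * s + 1) * m))) (coreGrid s m) x ω' <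
                11 * largeCount s (coreGrid s m) ω'}.indicator
            (fun ω' => (largeCount s (coreGrid s m) ω' : ℝ) ^ 2) ω) ∧
    (ω ∉ denseBox K s m →
      (∀ x : Site 3, 12 * joinedCount s ↑(box 3 (K * ((2 * s + 1) * m))) (coreGrid s m) x ω <
          11 * largeCount s (coreGrid s m) ω) ∨
      ∃ (i : Fin 2) (b : Bool), 6 * largeCount s (halfGrid s m i b) ω ≤ largeCount s (coreGrid s m) ω)

/-- Name-keyed statement of `stub_denseMarkov` (the second-moment boost): if the average in-`Λ(Kn)`
connection probability of the pairs of core grid points is `≥ (1 − η) θ_s²`, the dense block fails with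
probability `≤ 48 η + 200/(θ_s² m³)`. -/
def stub_denseMarkov : Prop :=
  ∀ (p : unitInterval) (K s m : ℕ) (η : ℝ), 1 ≤ K → 1 ≤ m →
    0 < (bondPercolation (zdGraph 3) p).real (siteToBoundary 3 s) →
    (1 - η) * (bondPercolation (zdGraph 3) p).real (siteToBoundary 3 s) ^ 2 *
        ((coreGrid s m).card : ℝ) ^ 2 ≤
      ∑ y ∈ coreGrid s m, ∑ y' ∈ coreGrid s m,
        (bondPercolation (zdGraph 3) p).real (openConnIn ↑(box 3 (K * ((2 * s + 1) * m))) y y') →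
    (bondPercolation (zdGraph 3) p).real (denseBox K s m)ᶜ ≤
      48 * η + 200 / ((bondPercolation (zdGraph 3) p).real (siteToBoundary 3 s) ^ 2 * (m : ℝ) ^ 3)

/-- Name-keyed statement of `stub_noLRO_K1`: no linear-scale finite-box LRO at `p_c` with `K = 1`
(connections inside `Λ(n)` itself): a face vertex of `Λ(n)` joined to the centre inside the box is a
half-space connection to depth `n`, rare by Barsky–Grimmett–Newman. -/
def stub_noLRO_K1 : Prop :=
  ¬ (∃ ρ : ℝ, 0 < ρ ∧ ∀ n : ℕ, 1 ≤ n → ∀ x ∈ box 3 n, ∀ y ∈ box 3 n,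
      ρ ≤ (bondPercolation (zdGraph 3) (criticalProbI 3)).real (openConnIn ↑(box 3 (1 * n)) x y))

/-- Name-keyed statement of `stub_critDense` (OPEN — the crux's residual content): linear-scale
finite-box LRO at `p_c` with `K ≥ 2` forces, for every positive `δ`-schedule, a dense block of some
ratio `K' ≥ 2` at some scale with probability `> 1 − δ K'`. -/
def stub_critDense : Prop :=
  ∀ (ρ : ℝ) (K : ℕ), 0 < ρ → 2 ≤ K →
    (∀ n : ℕ, 1 ≤ n → ∀ x ∈ box 3 n, ∀ y ∈ box 3 n,
      ρ ≤ (bondPercolation (zdGraph 3) (criticalProbI 3)).real (openConnIn ↑(box 3 (K * n)) x y)) →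
    ∀ δ : ℕ → ℝ, (∀ K', 0 < δ K') →
      ∃ K' s m : ℕ, 2 ≤ K' ∧ 1 ≤ m ∧
        1 - δ K' < (bondPercolation (zdGraph 3) (criticalProbI 3)).real (denseBox K' s m)

/-- Name-keyed statement of `stub_spineLocal` (reshape 3): for `2 ≤ K ≤ L`, `m ≥ 1`, the spine block is determined by
the pairs inside `Λ(2Ln)`, `n = (2s+1)m`. -/
def stub_spineLocal : Prop :=
  ∀ (K s m L : ℕ), 2 ≤ K → 1 ≤ m → K ≤ L →
    DeterminedBy (spineBox K s m L) (↑((box 3 (2 * L * ((2 * s + 1) * m))).sym2) : Set (Sym2 (Site 3)))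

/-- Name-keyed statement of `stub_spineGlue` (reshape 3): an infinite coarse cluster of spine blocks (spacing `L·n`)
carries an infinite open cluster meeting `Λ(Kn)` (consecutive windows of a spine glue by pigeonhole; the end window of
a spine is the centre window of the next spine; two base points of one dense window are joined). -/
def stub_spineGlue : Prop :=
  ∀ (K s m L : ℕ), 1 ≤ m → 1 ≤ L → ∀ (ω : BondConfig (Site 3)),
    blockCfg (L * ((2 * s + 1) * m)) (spineBox K s m L) ω ∈ percolatesAt (0 : Site 2) →
      ∃ x ∈ box 3 (K * ((2 * s + 1) * m)), ω ∈ percolatesAt x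

/-- Name-keyed statement of `stub_spineFailure` (reshape 3): the spine fails with probability at most `4L+2` times the
failure probability of one dense block (union bound over the windows + translation invariance). -/
def stub_spineFailure : Prop :=
  ∀ (p : unitInterval) (K s m L : ℕ),
    (bondPercolation (zdGraph 3) p).real (spineBox K s m L)ᶜ ≤
      (4 * L + 2) * (bondPercolation (zdGraph 3) p).real (denseBox K s m)ᶜ

/-- Name-keyed statement of `stub_critSpine` (OPEN — the crux's residual content after reshape 3; implied by
`stub_critDense`): linear-scale finite-box LRO at `p_c` with `K ≥ 2` forces, for every `δ > 0`, a spine block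
`spineBox K' s m L` (`2 ≤ K' ≤ L`, `m ≥ 1`) of probability `> 1 − δ`. -/
def stub_critSpine : Prop :=
  ∀ (ρ : ℝ) (K : ℕ), 0 < ρ → 2 ≤ K →
    (∀ n : ℕ, 1 ≤ n → ∀ x ∈ box 3 n, ∀ y ∈ box 3 n,
      ρ ≤ (bondPercolation (zdGraph 3) (criticalProbI 3)).real (openConnIn ↑(box 3 (K * n)) x y)) →
    ∀ δ : ℝ, 0 < δ →
      ∃ K' s m L : ℕ, 2 ≤ K' ∧ K' ≤ L ∧ 1 ≤ m ∧
        1 - δ < (bondPercolation (zdGraph 3) (criticalProbI 3)).real (spineBox K' s m L)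

/-- Name-keyed statement of `stub_twoArmsAllRatios` (lead cycle 3, LANDED p167450): an absolute `c > 0` with
`P_{p_c}(box two-arms at radii ((2s+1)m, K(2s+1)m)) ≥ c·θ(p_c)²/K` for every `K ≥ 2` and all large `s`, `m`. -/
def stub_twoArmsAllRatios : Prop :=
  ∃ c : ℝ, 0 < c ∧ ∀ K : ℕ, 2 ≤ K → ∃ s₀ : ℕ, ∀ s : ℕ, s₀ ≤ s → ∃ m₀ : ℕ, ∀ m : ℕ, m₀ ≤ m →
    c * theta (zdGraph 3) 0 (criticalProbI 3) ^ 2 / K ≤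
      (bondPercolation (zdGraph 3) (criticalProbI 3)).real
        {ω | ∃ x ∈ box 3 ((2 * s + 1) * m), ∃ x' ∈ box 3 ((2 * s + 1) * m),
          ∃ z ∈ innerBoundary (zdGraph 3) (box 3 (K * ((2 * s + 1) * m))),
            ∃ z' ∈ innerBoundary (zdGraph 3) (box 3 (K * ((2 * s + 1) * m))),
              ω ∈ openConnIn ↑(box 3 (K * ((2 * s + 1) * m))) x z ∧
                ω ∈ openConnIn ↑(box 3 (K * ((2 * s + 1) * m))) x' z' ∧
                  ω ∉ openConnIn ↑(box 3 (K * ((2 * s + 1) * m))) x x'}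

/-- Name-keyed statement of `stub_thetaZeroOfLinearTwoArmsRate` (lead cycle 3, LANDED p167450): a linear-scale box
two-arms rate `o(1/K)` at `p_c` (needed only if `θ(p_c) > 0`) gives `θ(p_c(ℤ³)) = 0`. -/
def stub_thetaZeroOfLinearTwoArmsRate : Prop :=
  (0 < theta (zdGraph 3) 0 (criticalProbI 3) →
    ∀ ε : ℝ, 0 < ε → ∃ K : ℕ, 2 ≤ K ∧ ∃ N : ℕ, ∀ n : ℕ, N ≤ n →
      (bondPercolation (zdGraph 3) (criticalProbI 3)).real
        {ω | ∃ x ∈ box 3 n, ∃ x' ∈ box 3 n,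
          ∃ z ∈ innerBoundary (zdGraph 3) (box 3 (K * n)), ∃ z' ∈ innerBoundary (zdGraph 3) (box 3 (K * n)),
            ω ∈ openConnIn ↑(box 3 (K * n)) x z ∧ ω ∈ openConnIn ↑(box 3 (K * n)) x' z' ∧
              ω ∉ openConnIn ↑(box 3 (K * n)) x x'} ≤ ε / K) →
  theta (zdGraph 3) 0 (criticalProbI 3) = 0

end Sig

/-! ## §1 Registered stubs -/

/-- **Stub I — GENERIC COARSE-LAW INPUTS** (dependence + density) for an arbitrary measurable local block
event `E` determined by the pairs inside `Λ(R)`: (i) under `blockLaw n E p`, measurable events determined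
by finite coarse edge sets whose vertices are pairwise at planar sup-distance `≥ D` are independent as soon
as `2R < D·n` (the regions `blockCentre n a + Λ(R)` are then disjoint; `bondPercolation_inter_of_disjoint`);
(ii) every lattice edge of `ℤ²` is coarse-open with probability `≥ 2·P_p(E) − 1` (translation invariance
`real_blockEvent` + inclusion–exclusion).  Ports of `stub_coarseDependent` (p148843) and
`stub_coarseDensity` (p149525) with `goodBox n ↦ E`.  LANDED: `…StubBlockLawInputs.lean` (p157445). -/
theorem stub_blockLawInputs :
    (∀ (p : unitInterval) (n R D : ℕ) (E : Set (BondConfig (Site 3))), 2 * R < D * n →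
        MeasurableSet E → DeterminedBy E (↑((box 3 R).sym2) : Set (Sym2 (Site 3))) →
        ∀ (F₁ F₂ : Finset (Sym2 (Site 2))),
          (∀ e₁ ∈ F₁, ∀ e₂ ∈ F₂, ∀ a ∈ e₁, ∀ b ∈ e₂, (D : ℤ) ≤ max |a 0 - b 0| |a 1 - b 1|) →
          ∀ (A B : Set (BondConfig (Site 2))), DeterminedBy A (↑F₁ : Set (Sym2 (Site 2))) →
            DeterminedBy B (↑F₂ : Set (Sym2 (Site 2))) → MeasurableSet A → MeasurableSet B →
            blockLaw n E p (A ∩ B) = blockLaw n E p A * blockLaw n E p B) ∧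
    (∀ (p : unitInterval) (n : ℕ) (E : Set (BondConfig (Site 3))), MeasurableSet E →
        ∀ e ∈ (zdGraph 2).edgeSet,
          2 * (bondPercolation (zdGraph 3) p).real E - 1 ≤ (blockLaw n E p).real {σ | e ∈ σ}) :=
  Summit.CriticalPhenomena.PercolationContinuityZ3.Theorems.RenormaliseFromLinearLRO.stub_blockLawInputs

/-- **Stub G — PIGEONHOLE GLUING (deterministic).**  If the cluster of the block `0` in the coarse
configuration of dense blocks (spacing `n = (2s+1)m`) is infinite, some vertex of `Λ(K n)` has an
infinite open cluster: the base points of two neighbouring dense blocks are joined in `ω`, since their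
joined sets are two strict majorities of the SAME finite set (the locally-large points of the common
half-grid — the block event at `a` is the dense block for the configuration shifted by `blockCentre n a`,
and `(2s+1) ∣ n` makes the shifted half-grids coincide), hence meet; induct along coarse paths and use
finite-to-one-ness of `a ↦ base point ∈ blockCentre n a + Λ(Kn)` as in `stub_coarseGlue` (p150840).  LANDED:
`…StubDenseGlue.lean` (p158137). -/
theorem stub_denseGlue :
    ∀ (K s m : ℕ), 1 ≤ m → ∀ (ω : BondConfig (Site 3)),
      blockCfg ((2 * s + 1) * m) (denseBox K s m) ω ∈ percolatesAt (0 : Site 2) →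
        ∃ x ∈ box 3 (K * ((2 * s + 1) * m)), ω ∈ percolatesAt x :=
  Summit.CriticalPhenomena.PercolationContinuityZ3.Theorems.RenormaliseFromLinearLRO.stub_denseGlue

/-- **Stub L — LOCALITY of the dense block** (PROVED in the objects file `…BlockDefs.lean`).  For `K ≥ 2`, `m ≥ 1` the dense block is determined by
the pairs inside `Λ(K n)`: each counted predicate is `ω ∈ armEvent y s` (determined by the pairs inside
`y + Λ(s) ⊆ Λ(n + s) ⊆ Λ(2n)`, `y` a core grid point) or `ω ∈ openConnIn Λ(Kn) x y` (determined by the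
pairs inside `Λ(Kn)`, `DCT16.determinedBy_openConnIn`); configurations agreeing on those pairs have the
same counted sets. -/
theorem stub_denseLocal :
    ∀ (K s m : ℕ), 2 ≤ K → 1 ≤ m →
      DeterminedBy (denseBox K s m) (↑((box 3 (K * ((2 * s + 1) * m))).sym2) : Set (Sym2 (Site 3))) :=
  Summit.CriticalPhenomena.PercolationContinuityZ3.Theorems.RenormaliseFromLinearLRO.stub_denseLocal

/-- **Stub M1 — MOMENTS of the number of locally-large points.**  For a finite set `G` of points
pairwise `≥ 2s+1` apart in some coordinate, `X = largeCount s G = Σ_{y ∈ G} 1_{armEvent y s}` has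
`E_p[X] = |G|·θ_s` (translation invariance `DCT16.real_armEvent`) and
`E_p[X²] = Σ_{y,y'} P_p(armEvent y s ∩ armEvent y' s) ≤ |G| θ_s + |G|² θ_s²` (for `y ≠ y'` the two arm
events are determined by the pairs inside the DISJOINT boxes `y + Λ(s)`, `y' + Λ(s)`, hence independent,
`DCT16.real_inter_of_determinedBy_disjoint`), `θ_s = P_p(siteToBoundary 3 s)`.  LANDED: `…StubLargeCountMoments.lean`
(p158461). -/
theorem stub_largeCountMoments :
    ∀ (p : unitInterval) (s : ℕ) (G : Finset (Site 3)),
      (∀ y ∈ G, ∀ y' ∈ G, y ≠ y' → ∃ i : Fin 3, ((2 * s + 1 : ℕ) : ℤ) ≤ |y i - y' i|) →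
      (∫ ω, (largeCount s G ω : ℝ) ∂(bondPercolation (zdGraph 3) p) =
          G.card * (bondPercolation (zdGraph 3) p).real (siteToBoundary 3 s)) ∧
      (∫ ω, (largeCount s G ω : ℝ) ^ 2 ∂(bondPercolation (zdGraph 3) p) ≤
          G.card * (bondPercolation (zdGraph 3) p).real (siteToBoundary 3 s) +
            (G.card : ℝ) ^ 2 * (bondPercolation (zdGraph 3) p).real (siteToBoundary 3 s) ^ 2) :=
  Summit.CriticalPhenomena.PercolationContinuityZ3.Theorems.RenormaliseFromLinearLRO.stub_largeCountMoments

/-- **Stub M2a — THE SECOND-MOMENT BOOST, deterministic half.**  `G` = core grid, `S = Λ(Kn)`,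
`X = largeCount s G`, `deg x = joinedCount s S G x`, `Y = Σ_{y,y' ∈ G} 1[y ↔ y' in S]`,
`F = {∀ x, 12·deg x < 11·X}`.  (A) For `ω ⊆ E(ℤ³)`: two DISTINCT grid points joined inside `S` are both
locally large (first exit from `y + Λ(s)`, `DCT16.armEvent_of_pathIn`; distinct grid points differ by
`≥ 2s+1 > s` in a coordinate), so `Y ≤ g + Σ_{y large} deg y`, and `deg y ≤ X` always, `12·deg y ≤ 11·X` on `F`:
`12 Y ≤ 12 g + 12 X² − 1_F X²`.  (E) If `ω` is not dense and `F` fails, pick `x` with `12·deg x ≥ 11·X`; for a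
half-grid `G_j ⊆ G` with large points `X_j` and joined points `J_j`: `joinedSet_j = largeSet_j ∩ joinedSet_G`,
so `X_j + deg x ≤ J_j + X` (`card_union_add_card_inter`), whence `X_j < 2 J_j` unless `6 X_j ≤ X`
(omega); not dense means some `j` has `2 J_j ≤ X_j`, hence `6 X_j ≤ X`.  LANDED: `…StubDenseMarkovPointwise.lean` (p159526). -/
theorem stub_denseMarkovPointwise :
    ∀ (K s m : ℕ) (ω : BondConfig (Site 3)),
      (ω ⊆ (zdGraph 3).edgeSet →
        12 * (∑ y ∈ coreGrid s m, ∑ y' ∈ coreGrid s m,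
            (openConnIn (↑(box 3 (K * ((2 * s + 1) * m))) : Set (Site 3)) y y').indicator
              (fun _ => (1 : ℝ)) ω) ≤
          12 * ((coreGrid s m).card : ℝ) + 12 * (largeCount s (coreGrid s m) ω : ℝ) ^ 2 -
            {ω' : BondConfig (Site 3) | ∀ x : Site 3,
                12 * joinedCount s ↑(box 3 (K * ((2 * s + 1) * m))) (coreGrid s m) x ω' <
                  11 * largeCount s (coreGrid s m) ω'}.indicator
              (fun ω' => (largeCount s (coreGrid s m) ω' : ℝ) ^ 2) ω) ∧
      (ω ∉ denseBox K s m →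
        (∀ x : Site 3, 12 * joinedCount s ↑(box 3 (K * ((2 * s + 1) * m))) (coreGrid s m) x ω <
            11 * largeCount s (coreGrid s m) ω) ∨
        ∃ (i : Fin 2) (b : Bool), 6 * largeCount s (halfGrid s m i b) ω ≤ largeCount s (coreGrid s m) ω) :=
  Summit.CriticalPhenomena.PercolationContinuityZ3.Theorems.RenormaliseFromLinearLRO.stub_denseMarkovPointwise

/-- **Stub M2 — THE SECOND-MOMENT BOOST (Markov).**  `G` = core grid (`g = (2m+1)³` points), `X` = number
of its locally-large points, `Y` = number of ordered pairs of grid points joined inside `Λ(Kn)`.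
Pointwise (`ω ⊆ E(ℤ³)`): two DISTINCT grid points joined inside `Λ(Kn)` are both locally large (first exit
from `y + Λ(s)`, `DCT16.armEvent_of_pathIn`), so `Y ≤ g + Σ_{y large} joinedCount(y) ≤ g + X² − 1_F·X²/12`
where `F = {∀ x, 12·joinedCount(x) < 11·X}`; off `F` some base point misses `≤ X/12` large grid points,
hence has a strict majority in every half-grid whose large points number `> X/6`, which holds when each
half count exceeds half its mean and `X < 3/2` of its mean (a half-grid has `≥ g/2` points).  Taking
expectations with the hypothesis `E[Y] ≥ (1−η)θ_s² g²` and `E[X²] ≤ g + θ_s² g²` (Stub M1) gives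
`E[1_F X²] ≤ 24 g + 12 η θ_s² g²`; Markov on `{X > θ_s g/2}` and Chebyshev (variance `≤ g`, Stub M1) for
the five count deviations give `P(not dense) ≤ 48 η + 116/(θ_s² g_half) ≤ 48 η + 200/(θ_s² m³)`.  LANDED:
`…StubDenseMarkov.lean` (p160841). -/
theorem stub_denseMarkov :
    ∀ (p : unitInterval) (K s m : ℕ) (η : ℝ), 1 ≤ K → 1 ≤ m →
      0 < (bondPercolation (zdGraph 3) p).real (siteToBoundary 3 s) →
      (1 - η) * (bondPercolation (zdGraph 3) p).real (siteToBoundary 3 s) ^ 2 *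
          ((coreGrid s m).card : ℝ) ^ 2 ≤
        ∑ y ∈ coreGrid s m, ∑ y' ∈ coreGrid s m,
          (bondPercolation (zdGraph 3) p).real (openConnIn ↑(box 3 (K * ((2 * s + 1) * m))) y y') →
      (bondPercolation (zdGraph 3) p).real (denseBox K s m)ᶜ ≤
        48 * η + 200 / ((bondPercolation (zdGraph 3) p).real (siteToBoundary 3 s) ^ 2 * (m : ℝ) ^ 3) :=
  Summit.CriticalPhenomena.PercolationContinuityZ3.Theorems.RenormaliseFromLinearLRO.stub_denseMarkov

/-- **Stub B — THE BOUNDARY CASE `K = 1` (Barsky–Grimmett–Newman).**  With `K = 1` the hypothesis joins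
the face vertex `w = n e₀ ∈ ∂ⁱⁿΛ(n)` to the centre `0 ∈ Λ(n − n)` INSIDE `Λ(n)` with probability `≥ ρ` for
every `n`; but `P_{p_c}(w ↔ 0 inside Λ(n)) ≤ P_{p_c}(0 ↔ height n inside ℍ) → 0`
(`BoxGateway.real_openConnVia_box_le_halfSpaceReach`, `openConnIn_ae_eq_openConnVia`,
`CerfDembinVanishing.tendsto_measure_halfSpaceReach` with `θ_ℍ(p_c) = 0`, the tree's proved
`BarskyGrimmettNewman1991_Z3_holds`).  LANDED: `…StubNoLROK1.lean` (p158904). -/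
theorem stub_noLRO_K1 :
    ¬ (∃ ρ : ℝ, 0 < ρ ∧ ∀ n : ℕ, 1 ≤ n → ∀ x ∈ box 3 n, ∀ y ∈ box 3 n,
        ρ ≤ (bondPercolation (zdGraph 3) (criticalProbI 3)).real (openConnIn ↑(box 3 (1 * n)) x y)) :=
  Summit.CriticalPhenomena.PercolationContinuityZ3.Theorems.RenormaliseFromLinearLRO.stub_noLRO_K1

/-- **Stub S1 — LOCALITY of the spine block** (PROVED in the objects file `…SpineDefs.lean`). -/
theorem stub_spineLocal :
    ∀ (K s m L : ℕ), 2 ≤ K → 1 ≤ m → K ≤ L →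
      DeterminedBy (spineBox K s m L) (↑((box 3 (2 * L * ((2 * s + 1) * m))).sym2) : Set (Sym2 (Site 3))) :=
  Summit.CriticalPhenomena.PercolationContinuityZ3.Theorems.RenormaliseFromLinearLRO.stub_spineLocal

/-- **Stub S2 — GLUING OF SPINES (deterministic).**  If the cluster of `0` in the coarse configuration of spine
blocks (spacing `L·n`, `n = (2s+1)m`, `m, L ≥ 1`) is infinite, some vertex of `Λ(Kn)` has an infinite open cluster.
Mechanism: inside a spine block `a` the windows `L·a + j·eᵢ`, `j = 0, 1, …, L` (resp. `0, −1, …, −L`) are all dense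
(`mem_blockEvent_spineBox_iff`), consecutive ones glue by `dense_reachable_of_adj` (p158137), so the base point of the
centre window is joined to a base point of the window `L·a ± L·eᵢ = L·(a ± eᵢ)`, which is the CENTRE window of the
neighbouring spine block; two base points of one dense window are joined (each has a strict majority in the same
half-grid).  Induct along coarse paths; finite-to-one as in `stub_denseGlue`.  LANDED: `…StubSpineGlue.lean` (p162811). -/
theorem stub_spineGlue :
    ∀ (K s m L : ℕ), 1 ≤ m → 1 ≤ L → ∀ (ω : BondConfig (Site 3)),
      blockCfg (L * ((2 * s + 1) * m)) (spineBox K s m L) ω ∈ percolatesAt (0 : Site 2) →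
        ∃ x ∈ box 3 (K * ((2 * s + 1) * m)), ω ∈ percolatesAt x :=
  Summit.CriticalPhenomena.PercolationContinuityZ3.Theorems.RenormaliseFromLinearLRO.stub_spineGlue

/-- **Stub S3 — THE UNION BOUND.**  `P_p(spine fails) ≤ (4L+2)·P_p(dense block fails)`: the complement of the spine
is the union over `i ∈ {0,1}`, `|j| ≤ L` of the complements of the translated dense blocks
`blockEvent n (denseBox K s m) (j·eᵢ)`, each of probability `P_p((denseBox K s m)ᶜ)` by translation invariance
(`bondPercolation_real_preimage_shift`; the complement of a preimage is the preimage of the complement);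
`measureReal_biUnion_finset_le` over the `2(2L+1)` windows.  LANDED: `…StubSpineFailure.lean` (p163025). -/
theorem stub_spineFailure :
    ∀ (p : unitInterval) (K s m L : ℕ),
      (bondPercolation (zdGraph 3) p).real (spineBox K s m L)ᶜ ≤
        (4 * L + 2) * (bondPercolation (zdGraph 3) p).real (denseBox K s m)ᶜ :=
  Summit.CriticalPhenomena.PercolationContinuityZ3.Theorems.RenormaliseFromLinearLRO.stub_spineFailure

/-- **Stub T1 — LINEAR TWO-ARMS AT A PERCOLATING `p_c`, EVERY RATIO** (lead cycle 3, LANDED: `…TwoArmsFrontier.lean`,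
p167450).  An absolute `c > 0` (`= δ₀/2000`) with `P_{p_c}(box two-arms at radii ((2s+1)m, K(2s+1)m)) ≥ c·θ(p_c)²/K` for every
`K ≥ 2`, all large `s` and, given `s`, all large `m`; trivial iff `θ(p_c) = 0`.  Proof: the proof of p163651 read with the
hypothesis `0 < θ(p_c)` in place of `LRO_lin(p_c)` (`pairSum_lt_criticalProbI` + `twoArms_real_mul_ge`, `θ_s ↓ θ`, `g → ∞`). -/
theorem stub_twoArmsAllRatios :
    ∃ c : ℝ, 0 < c ∧ ∀ K : ℕ, 2 ≤ K → ∃ s₀ : ℕ, ∀ s : ℕ, s₀ ≤ s → ∃ m₀ : ℕ, ∀ m : ℕ, m₀ ≤ m →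
      c * theta (zdGraph 3) 0 (criticalProbI 3) ^ 2 / K ≤
        (bondPercolation (zdGraph 3) (criticalProbI 3)).real
          {ω | ∃ x ∈ box 3 ((2 * s + 1) * m), ∃ x' ∈ box 3 ((2 * s + 1) * m),
            ∃ z ∈ innerBoundary (zdGraph 3) (box 3 (K * ((2 * s + 1) * m))),
              ∃ z' ∈ innerBoundary (zdGraph 3) (box 3 (K * ((2 * s + 1) * m))),
                ω ∈ openConnIn ↑(box 3 (K * ((2 * s + 1) * m))) x z ∧
                  ω ∈ openConnIn ↑(box 3 (K * ((2 * s + 1) * m))) x' z' ∧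
                    ω ∉ openConnIn ↑(box 3 (K * ((2 * s + 1) * m))) x x'} :=
  Summit.CriticalPhenomena.PercolationContinuityZ3.Theorems.RenormaliseFromLinearLRO.stub_twoArmsAllRatios

/-- **Stub T2 — `θ(p_c) = 0` FROM A LINEAR TWO-ARMS RATE** (lead cycle 3, LANDED: `…TwoArmsFrontier.lean`, p167450).  If, in
the percolating world `θ(p_c) > 0`, linear-scale box two-arms is `o(1/K)` (`∀ ε > 0, ∃ K ≥ 2, ∃ N, ∀ n ≥ N,
P_{p_c}(two-arms(n, K·n)) ≤ ε/K`), then `θ(p_c) = 0`.  Proof: Stub T1 with `ε := c·θ(p_c)²/2`. -/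
theorem stub_thetaZeroOfLinearTwoArmsRate :
    (0 < theta (zdGraph 3) 0 (criticalProbI 3) →
      ∀ ε : ℝ, 0 < ε → ∃ K : ℕ, 2 ≤ K ∧ ∃ N : ℕ, ∀ n : ℕ, N ≤ n →
        (bondPercolation (zdGraph 3) (criticalProbI 3)).real
          {ω | ∃ x ∈ box 3 n, ∃ x' ∈ box 3 n,
            ∃ z ∈ innerBoundary (zdGraph 3) (box 3 (K * n)), ∃ z' ∈ innerBoundary (zdGraph 3) (box 3 (K * n)),
              ω ∈ openConnIn ↑(box 3 (K * n)) x z ∧ ω ∈ openConnIn ↑(box 3 (K * n)) x' z' ∧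
                ω ∉ openConnIn ↑(box 3 (K * n)) x x'} ≤ ε / K) →
    theta (zdGraph 3) 0 (criticalProbI 3) = 0 :=
  Summit.CriticalPhenomena.PercolationContinuityZ3.Theorems.RenormaliseFromLinearLRO.stub_thetaZeroOfLinearTwoArmsRate

/-- **Stub D' — SPINE BLOCKS AT CRITICALITY (load-bearing, OPEN; the crux's residual content after reshape 3).**  If
at `p_c` there are `ρ > 0` and `K ≥ 2` with `P_{p_c}(x ↔ y inside Λ(Kn)) ≥ ρ` for all `n ≥ 1`, `x, y ∈ Λ(n)`, then for
every `δ > 0` some spine block `spineBox K' s m L` (`2 ≤ K' ≤ L`, `m ≥ 1`) has `P_{p_c}`-probability `> 1 − δ`.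
Implied by `stub_critDense` (`critSpine_of_critDense` below, via Stub S3); PROVED when `ρ ≥ (1 − c₀/K)·θ(p_c)²` for
an ABSOLUTE constant `c₀` (`not_nearMaximal_linearLRO_criticalProbI'`).  Equivalent to the crux given the rest. -/
theorem stub_critSpine :
    ∀ (ρ : ℝ) (K : ℕ), 0 < ρ → 2 ≤ K →
      (∀ n : ℕ, 1 ≤ n → ∀ x ∈ box 3 n, ∀ y ∈ box 3 n,
        ρ ≤ (bondPercolation (zdGraph 3) (criticalProbI 3)).real (openConnIn ↑(box 3 (K * n)) x y)) →
      ∀ δ : ℝ, 0 < δ →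
        ∃ K' s m L : ℕ, 2 ≤ K' ∧ K' ≤ L ∧ 1 ≤ m ∧
          1 - δ < (bondPercolation (zdGraph 3) (criticalProbI 3)).real (spineBox K' s m L) := by
  sorry

/-! ## §2 Glue (LANDED as `Theorems/PercFiniteBoxLRORenormaliseFromLinearLRODenseCriterion.lean`, p161630):
the dense-block criterion `denseCriterion`, no dense blocks at `p_c` (`stub_noDenseBoxAtPc`), the LRO constant bound
`lro_le_theta_sq`, the near-maximal regime `stub_noNearMaximalLRO`, and the composition from the open stub.  Here they
are re-exported into the skeleton's namespace. -/

/-- **The same-`p` DENSE-BLOCK criterion** (tree: `denseCriterion`): `∀ K ≥ 2, ∃ δ > 0, ∀ p s m, 1 ≤ m →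
P_p(denseBox K s m) > 1 − δ → θ(p) > 0`. -/
theorem denseCriterion (K : ℕ) (hK : 2 ≤ K) :
    ∃ δ : ℝ, 0 < δ ∧ ∀ (p : unitInterval) (s m : ℕ), 1 ≤ m →
      1 - δ < (bondPercolation (zdGraph 3) p).real (denseBox K s m) → 0 < theta (zdGraph 3) 0 p :=
  Summit.CriticalPhenomena.PercolationContinuityZ3.Theorems.RenormaliseFromLinearLRO.denseCriterion K hK

/-- **No dense blocks at criticality** (tree: `stub_noDenseBoxAtPc`, unconditional). -/
theorem real_denseBox_criticalProbI_le (K : ℕ) (hK : 2 ≤ K) :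
    ∃ δ : ℝ, 0 < δ ∧ ∀ s m : ℕ, 1 ≤ m →
      (bondPercolation (zdGraph 3) (criticalProbI 3)).real (denseBox K s m) ≤ 1 - δ :=
  Summit.CriticalPhenomena.PercolationContinuityZ3.Theorems.RenormaliseFromLinearLRO.stub_noDenseBoxAtPc K hK

/-- **The LRO constant is at most `θ(p)²`** (tree: `lro_le_theta_sq`). -/
theorem lro_le_theta_sq (p : unitInterval) {ρ : ℝ} {K : ℕ}
    (h : ∀ n : ℕ, 1 ≤ n → ∀ x ∈ box 3 n, ∀ y ∈ box 3 n,
      ρ ≤ (bondPercolation (zdGraph 3) p).real (openConnIn ↑(box 3 (K * n)) x y)) :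
    ρ ≤ theta (zdGraph 3) 0 p ^ 2 :=
  Summit.CriticalPhenomena.PercolationContinuityZ3.Theorems.RenormaliseFromLinearLRO.lro_le_theta_sq p h

/-- **No linear-scale finite-box LRO at `p_c`** from the one open stub (tree:
`not_linearLRO_criticalProbI_of_critDense`): `K = 0` vacuous, `K = 1` Barsky–Grimmett–Newman (`stub_noLRO_K1`),
`K ≥ 2` the dense-block route. -/
theorem not_linearLRO_criticalProbI₂ (hD : Sig.stub_critDense) :
    ¬ (∃ ρ : ℝ, 0 < ρ ∧ ∃ K : ℕ, ∀ n : ℕ, 1 ≤ n → ∀ x ∈ box 3 n, ∀ y ∈ box 3 n,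
        ρ ≤ (bondPercolation (zdGraph 3) (criticalProbI 3)).real (openConnIn ↑(box 3 (K * n)) x y)) :=
  Summit.CriticalPhenomena.PercolationContinuityZ3.Theorems.RenormaliseFromLinearLRO.not_linearLRO_criticalProbI_of_critDense hD

/-- **The near-maximal regime of the open stub, PROVED** (tree: `stub_noNearMaximalLRO`, unconditional): for every
`K ≥ 2` there is `η₀ > 0` such that `LRO_lin(p_c)` with constants `(ρ, K)` is impossible once `ρ ≥ (1 − η₀)·θ(p_c)²`. -/
theorem not_nearMaximal_linearLRO_criticalProbI (K : ℕ) (hK : 2 ≤ K) :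
    ∃ η₀ : ℝ, 0 < η₀ ∧ ∀ ρ : ℝ, 0 < ρ →
      (1 - η₀) * theta (zdGraph 3) 0 (criticalProbI 3) ^ 2 ≤ ρ →
      ¬ (∀ n : ℕ, 1 ≤ n → ∀ x ∈ box 3 n, ∀ y ∈ box 3 n,
          ρ ≤ (bondPercolation (zdGraph 3) (criticalProbI 3)).real (openConnIn ↑(box 3 (K * n)) x y)) :=
  Summit.CriticalPhenomena.PercolationContinuityZ3.Theorems.RenormaliseFromLinearLRO.stub_noNearMaximalLRO K hK

/-! ## §2b Glue of reshape 3 (LANDED as `Theorems/PercFiniteBoxLRORenormaliseFromLinearLROSpineCriterion.lean`,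
p163218): the spine criterion with one threshold, no spines at `p_c`, the near-maximal regime with a `1/K` window, the
weakening `critSpine_of_critDense`, and the composition from the open stub — re-exported into the skeleton's namespace. -/

/-- **The same-`p` SPINE criterion, one threshold for all ratios** (tree: `spineCriterion`). -/
theorem spineCriterion :
    ∃ δ₀ : ℝ, 0 < δ₀ ∧ ∀ (K L : ℕ), 2 ≤ K → K ≤ L → ∀ (p : unitInterval) (s m : ℕ), 1 ≤ m →
      1 - δ₀ < (bondPercolation (zdGraph 3) p).real (spineBox K s m L) → 0 < theta (zdGraph 3) 0 p :=
  Summit.CriticalPhenomena.PercolationContinuityZ3.Theorems.RenormaliseFromLinearLRO.spineCriterion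

/-- **No spines at criticality** (tree: `stub_noSpineAtPc`, unconditional). -/
theorem real_spineBox_criticalProbI_le :
    ∃ δ₀ : ℝ, 0 < δ₀ ∧ ∀ (K L : ℕ), 2 ≤ K → K ≤ L → ∀ s m : ℕ, 1 ≤ m →
      (bondPercolation (zdGraph 3) (criticalProbI 3)).real (spineBox K s m L) ≤ 1 - δ₀ :=
  Summit.CriticalPhenomena.PercolationContinuityZ3.Theorems.RenormaliseFromLinearLRO.stub_noSpineAtPc

/-- **`¬LRO_lin(p_c)` from the open spine stub** (tree: `not_linearLRO_criticalProbI_of_critSpine`). -/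
theorem not_linearLRO_criticalProbI₃ (hD : Sig.stub_critSpine) :
    ¬ (∃ ρ : ℝ, 0 < ρ ∧ ∃ K : ℕ, ∀ n : ℕ, 1 ≤ n → ∀ x ∈ box 3 n, ∀ y ∈ box 3 n,
        ρ ≤ (bondPercolation (zdGraph 3) (criticalProbI 3)).real (openConnIn ↑(box 3 (K * n)) x y)) :=
  Summit.CriticalPhenomena.PercolationContinuityZ3.Theorems.RenormaliseFromLinearLRO.not_linearLRO_criticalProbI_of_critSpine hD

/-- **The near-maximal regime with a `1/K` window, PROVED** (tree: `stub_noNearMaximalLRO_inv`, unconditional): an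
absolute `c₀ > 0` with — for every `K ≥ 2`, no `LRO_lin(p_c)` with constants `(ρ, K)` once `ρ ≥ (1 − c₀/K)·θ(p_c)²`. -/
theorem not_nearMaximal_linearLRO_criticalProbI' :
    ∃ c₀ : ℝ, 0 < c₀ ∧ ∀ K : ℕ, 2 ≤ K → ∀ ρ : ℝ, 0 < ρ →
      (1 - c₀ / K) * theta (zdGraph 3) 0 (criticalProbI 3) ^ 2 ≤ ρ →
      ¬ (∀ n : ℕ, 1 ≤ n → ∀ x ∈ box 3 n, ∀ y ∈ box 3 n,
          ρ ≤ (bondPercolation (zdGraph 3) (criticalProbI 3)).real (openConnIn ↑(box 3 (K * n)) x y)) :=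
  Summit.CriticalPhenomena.PercolationContinuityZ3.Theorems.RenormaliseFromLinearLRO.stub_noNearMaximalLRO_inv

/-- **Anatomy: the spine stub is implied by the dense stub** (tree: `critSpine_of_critDense`). -/
theorem critSpine_of_critDense (hD : Sig.stub_critDense) : Sig.stub_critSpine :=
  Summit.CriticalPhenomena.PercolationContinuityZ3.Theorems.RenormaliseFromLinearLRO.critSpine_of_critDense hD

/-- **Anatomy of the residual: `LRO_lin(p_c)` forces linear two-arms** (tree: `stub_lroForcesLinearTwoArms`,
p163651): in a hypothetical world with `LRO_lin(p_c)` (`K ≥ 2`), the r5 box two-arms event at radii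
`(n, K·n)`, `n = (2s+1)m`, has `P_{p_c}`-probability `≥ c > 0` for all large `s` and, given `s`, all large `m`. -/
theorem lroForcesLinearTwoArms :
    ∀ (ρ : ℝ) (K : ℕ), 0 < ρ → 2 ≤ K →
      (∀ n : ℕ, 1 ≤ n → ∀ x ∈ box 3 n, ∀ y ∈ box 3 n,
        ρ ≤ (bondPercolation (zdGraph 3) (criticalProbI 3)).real (openConnIn ↑(box 3 (K * n)) x y)) →
      ∃ c : ℝ, 0 < c ∧ ∃ s₀ : ℕ, ∀ s : ℕ, s₀ ≤ s → ∃ m₀ : ℕ, ∀ m : ℕ, m₀ ≤ m →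
        c ≤ (bondPercolation (zdGraph 3) (criticalProbI 3)).real
          {ω | ∃ x ∈ box 3 ((2 * s + 1) * m), ∃ x' ∈ box 3 ((2 * s + 1) * m),
            ∃ z ∈ innerBoundary (zdGraph 3) (box 3 (K * ((2 * s + 1) * m))),
              ∃ z' ∈ innerBoundary (zdGraph 3) (box 3 (K * ((2 * s + 1) * m))),
                ω ∈ openConnIn ↑(box 3 (K * ((2 * s + 1) * m))) x z ∧
                  ω ∈ openConnIn ↑(box 3 (K * ((2 * s + 1) * m))) x' z' ∧
                    ω ∉ openConnIn ↑(box 3 (K * ((2 * s + 1) * m))) x x'} :=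
  Summit.CriticalPhenomena.PercolationContinuityZ3.Theorems.RenormaliseFromLinearLRO.stub_lroForcesLinearTwoArms

/-! ## §3 Composition (kernel-checked, no `sorry`): the stubs give the crux by name -/

theorem RenormaliseFromLinearLRO_of (hD : Sig.stub_critSpine) :
    Summit.CriticalPhenomena.PercolationContinuityZ3.Theses.PercFiniteBoxLRO.RenormaliseFromLinearLRO :=
  renormaliseFromLinearLRO_of_not_linearLRO_criticalProbI (not_linearLRO_criticalProbI₃ hD)

/-! ## §4 Definitional consistency: the registered stubs feed the composition verbatim -/

/-- Registered Stub I IS `Sig.stub_blockLawInputs`. -/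
theorem blockLawInputs_registered : Sig.stub_blockLawInputs := stub_blockLawInputs
/-- Registered Stub G IS `Sig.stub_denseGlue`. -/
theorem denseGlue_registered : Sig.stub_denseGlue := stub_denseGlue
/-- Registered Stub L IS `Sig.stub_denseLocal`. -/
theorem denseLocal_registered : Sig.stub_denseLocal := stub_denseLocal
/-- Registered Stub M1 IS `Sig.stub_largeCountMoments`. -/
theorem largeCountMoments_registered : Sig.stub_largeCountMoments := stub_largeCountMoments
/-- Registered Stub M2a IS `Sig.stub_denseMarkovPointwise`. -/
theorem denseMarkovPointwise_registered : Sig.stub_denseMarkovPointwise := stub_denseMarkovPointwise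
/-- Registered Stub M2 IS `Sig.stub_denseMarkov`. -/
theorem denseMarkov_registered : Sig.stub_denseMarkov := stub_denseMarkov
/-- Registered Stub B IS `Sig.stub_noLRO_K1`. -/
theorem noLRO_K1_registered : Sig.stub_noLRO_K1 := stub_noLRO_K1
/-- Registered Stub S1 IS `Sig.stub_spineLocal`. -/
theorem spineLocal_registered : Sig.stub_spineLocal := stub_spineLocal
/-- Registered Stub S2 IS `Sig.stub_spineGlue`. -/
theorem spineGlue_registered : Sig.stub_spineGlue := stub_spineGlue
/-- Registered Stub S3 IS `Sig.stub_spineFailure`. -/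
theorem spineFailure_registered : Sig.stub_spineFailure := stub_spineFailure
/-- Registered Stub D' IS `Sig.stub_critSpine`. -/
theorem critSpine_registered : Sig.stub_critSpine := stub_critSpine
/-- Registered Stub T1 IS `Sig.stub_twoArmsAllRatios`. -/
theorem twoArmsAllRatios_registered : Sig.stub_twoArmsAllRatios := stub_twoArmsAllRatios
/-- Registered Stub T2 IS `Sig.stub_thetaZeroOfLinearTwoArmsRate`. -/
theorem thetaZeroOfLinearTwoArmsRate_registered : Sig.stub_thetaZeroOfLinearTwoArmsRate :=
  stub_thetaZeroOfLinearTwoArmsRate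

/- The crux from the registered stubs (an `example`, so no `sorry`-tainted proof of the crux enters the
environment). -/
example : Summit.CriticalPhenomena.PercolationContinuityZ3.Theses.PercFiniteBoxLRO.RenormaliseFromLinearLRO :=
  RenormaliseFromLinearLRO_of stub_critSpine

/- The near-maximal regime from the registered stubs. -/
example (K : ℕ) (hK : 2 ≤ K) :
    ∃ η₀ : ℝ, 0 < η₀ ∧ ∀ ρ : ℝ, 0 < ρ →
      (1 - η₀) * theta (zdGraph 3) 0 (criticalProbI 3) ^ 2 ≤ ρ →
      ¬ (∀ n : ℕ, 1 ≤ n → ∀ x ∈ box 3 n, ∀ y ∈ box 3 n,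
          ρ ≤ (bondPercolation (zdGraph 3) (criticalProbI 3)).real (openConnIn ↑(box 3 (K * n)) x y)) :=
  not_nearMaximal_linearLRO_criticalProbI K hK

/-! ## §5 Anatomy (kernel-checked): the open stub, the crux and `¬LRO_lin(p_c)` are EQUIVALENT -/

/-- `stub_critSpine` is equivalent to the crux `RenormaliseFromLinearLRO` (→ : the composition; ← : the crux forbids
`LRO_lin(p_c)` (`not_linearLRO_criticalProbI_of_renormaliseFromLinearLRO`, p152652), making the stub vacuous).  So
reshapes 2–3 have not hidden any difficulty: what is open is exactly the crux, now in the form "uniform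
`ρ`-connectivity at all linear scales ⇒ ONE likely spine block". -/
theorem stub_critSpine_iff_crux :
    Sig.stub_critSpine ↔
      Summit.CriticalPhenomena.PercolationContinuityZ3.Theses.PercFiniteBoxLRO.RenormaliseFromLinearLRO := by
  constructor
  · exact RenormaliseFromLinearLRO_of
  · intro hR ρ K hρ _hK hLRO
    exact absurd ⟨ρ, hρ, K, hLRO⟩ (not_linearLRO_criticalProbI_of_renormaliseFromLinearLRO hR)

/-! ## §5b Anatomy of lead cycle 3 (kernel-checked): the two-arms frontier of the line

The hypothesis of Stub T2 — a linear-scale box two-arms RATE `o(1/K)` in the percolating world — gives the sub-problem's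
conjunct, hence `¬LRO_lin(p_c)`, the crux and the open stub.  Read together with Stub T1 this says: the same-`p` boost of this
line (second moment over dense/spine blocks) closes the crux EXACTLY when linear two-arms is `o(1/K)` in the hypothetical LRO
world, and that much input already proves `θ(p_c) = 0`. -/

/-- The sub-problem's conjunct `PercolationContinuityZ3` (`θ_{ℤ³}(p_c) = 0`) from the rate hypothesis of Stub T2 (tree:
`percolationContinuityZ3_of_linearTwoArms_littleO`, p167450). -/
theorem conjunct_of_linearTwoArmsRate
    (hX : 0 < theta (zdGraph 3) 0 (criticalProbI 3) →
      ∀ ε : ℝ, 0 < ε → ∃ K : ℕ, 2 ≤ K ∧ ∃ N : ℕ, ∀ n : ℕ, N ≤ n →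
        (bondPercolation (zdGraph 3) (criticalProbI 3)).real
          {ω | ∃ x ∈ box 3 n, ∃ x' ∈ box 3 n,
            ∃ z ∈ innerBoundary (zdGraph 3) (box 3 (K * n)), ∃ z' ∈ innerBoundary (zdGraph 3) (box 3 (K * n)),
              ω ∈ openConnIn ↑(box 3 (K * n)) x z ∧ ω ∈ openConnIn ↑(box 3 (K * n)) x' z' ∧
                ω ∉ openConnIn ↑(box 3 (K * n)) x x'} ≤ ε / K) :
    Literature.Probability.Percolation.PercolationContinuityZ3 :=
  percolationContinuityZ3_of_linearTwoArms_littleO hX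

/-- The crux BY NAME from the rate hypothesis of Stub T2 (tree: `renormaliseFromLinearLRO_of_linearTwoArms_littleO`, p167450). -/
theorem crux_of_linearTwoArmsRate
    (hX : 0 < theta (zdGraph 3) 0 (criticalProbI 3) →
      ∀ ε : ℝ, 0 < ε → ∃ K : ℕ, 2 ≤ K ∧ ∃ N : ℕ, ∀ n : ℕ, N ≤ n →
        (bondPercolation (zdGraph 3) (criticalProbI 3)).real
          {ω | ∃ x ∈ box 3 n, ∃ x' ∈ box 3 n,
            ∃ z ∈ innerBoundary (zdGraph 3) (box 3 (K * n)), ∃ z' ∈ innerBoundary (zdGraph 3) (box 3 (K * n)),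
              ω ∈ openConnIn ↑(box 3 (K * n)) x z ∧ ω ∈ openConnIn ↑(box 3 (K * n)) x' z' ∧
                ω ∉ openConnIn ↑(box 3 (K * n)) x x'} ≤ ε / K) :
    Summit.CriticalPhenomena.PercolationContinuityZ3.Theses.PercFiniteBoxLRO.RenormaliseFromLinearLRO :=
  renormaliseFromLinearLRO_of_linearTwoArms_littleO hX

/-- The open stub `Sig.stub_critSpine` from the rate hypothesis of Stub T2 (tree: `critSpine_of_linearTwoArms_littleO`,
p167450) — so `Sig.stub_thetaZeroOfLinearTwoArmsRate`'s hypothesis is a sufficient input for the line. -/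
theorem critSpine_of_linearTwoArmsRate
    (hX : 0 < theta (zdGraph 3) 0 (criticalProbI 3) →
      ∀ ε : ℝ, 0 < ε → ∃ K : ℕ, 2 ≤ K ∧ ∃ N : ℕ, ∀ n : ℕ, N ≤ n →
        (bondPercolation (zdGraph 3) (criticalProbI 3)).real
          {ω | ∃ x ∈ box 3 n, ∃ x' ∈ box 3 n,
            ∃ z ∈ innerBoundary (zdGraph 3) (box 3 (K * n)), ∃ z' ∈ innerBoundary (zdGraph 3) (box 3 (K * n)),
              ω ∈ openConnIn ↑(box 3 (K * n)) x z ∧ ω ∈ openConnIn ↑(box 3 (K * n)) x' z' ∧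
                ω ∉ openConnIn ↑(box 3 (K * n)) x x'} ≤ ε / K) :
    Sig.stub_critSpine :=
  critSpine_of_linearTwoArms_littleO hX

/-- The rate hypothesis from a linear-scale box two-arms EXPONENT `> 1` (tree: `linearTwoArms_littleO_of_exponent`, p167450);
believed `≈ 1.14` in `d = 3` (backbone dimension `≈ 1.86`), in print only `≥ 12/23` for the POINT event (Cerf2015 Thm 1.1). -/
theorem linearTwoArmsRate_of_exponent
    (hγ : ∃ γ : ℝ, 1 < γ ∧ ∃ C : ℝ, ∀ K : ℕ, 2 ≤ K → ∃ N : ℕ, ∀ n : ℕ, N ≤ n →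
      (bondPercolation (zdGraph 3) (criticalProbI 3)).real
        {ω | ∃ x ∈ box 3 n, ∃ x' ∈ box 3 n,
          ∃ z ∈ innerBoundary (zdGraph 3) (box 3 (K * n)), ∃ z' ∈ innerBoundary (zdGraph 3) (box 3 (K * n)),
            ω ∈ openConnIn ↑(box 3 (K * n)) x z ∧ ω ∈ openConnIn ↑(box 3 (K * n)) x' z' ∧
              ω ∉ openConnIn ↑(box 3 (K * n)) x x'} ≤ C * (K : ℝ) ^ (-γ)) :
    ∀ ε : ℝ, 0 < ε → ∃ K : ℕ, 2 ≤ K ∧ ∃ N : ℕ, ∀ n : ℕ, N ≤ n →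
      (bondPercolation (zdGraph 3) (criticalProbI 3)).real
        {ω | ∃ x ∈ box 3 n, ∃ x' ∈ box 3 n,
          ∃ z ∈ innerBoundary (zdGraph 3) (box 3 (K * n)), ∃ z' ∈ innerBoundary (zdGraph 3) (box 3 (K * n)),
            ω ∈ openConnIn ↑(box 3 (K * n)) x z ∧ ω ∈ openConnIn ↑(box 3 (K * n)) x' z' ∧
              ω ∉ openConnIn ↑(box 3 (K * n)) x x'} ≤ ε / K :=
  linearTwoArms_littleO_of_exponent hγ

/-- **Honesty check (kernel-checked): the GUARDED rate hypothesis of Stub T2 is EQUIVALENT to the conjunct `θ(p_c) = 0`**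
(`←` is vacuous).  So the informative sufficient input of the line found in cycle 3 is the UNGUARDED rate
`∀ ε > 0, ∃ K ≥ 2, ∃ N, ∀ n ≥ N, P_{p_c}(two-arms(n, K·n)) ≤ ε/K` — a statement about the real critical point of `ℤ³`
(believed `≍ K^{-1.14}`; dimension-sensitive, false for `d > 6`), not provable today; tree: `linearTwoArmsRateGuarded_iff`. -/
theorem rateGuarded_iff_conjunct :
    Sig.stub_thetaZeroOfLinearTwoArmsRate ∧
    ((0 < theta (zdGraph 3) 0 (criticalProbI 3) →
      ∀ ε : ℝ, 0 < ε → ∃ K : ℕ, 2 ≤ K ∧ ∃ N : ℕ, ∀ n : ℕ, N ≤ n →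
        (bondPercolation (zdGraph 3) (criticalProbI 3)).real
          {ω | ∃ x ∈ box 3 n, ∃ x' ∈ box 3 n,
            ∃ z ∈ innerBoundary (zdGraph 3) (box 3 (K * n)), ∃ z' ∈ innerBoundary (zdGraph 3) (box 3 (K * n)),
              ω ∈ openConnIn ↑(box 3 (K * n)) x z ∧ ω ∈ openConnIn ↑(box 3 (K * n)) x' z' ∧
                ω ∉ openConnIn ↑(box 3 (K * n)) x x'} ≤ ε / K) ↔
    Literature.Probability.Percolation.PercolationContinuityZ3) :=
  ⟨stub_thetaZeroOfLinearTwoArmsRate,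
    ⟨stub_thetaZeroOfLinearTwoArmsRate, fun h0 hpos => absurd (percolationContinuityZ3_iff.1 h0) (ne_of_gt hpos)⟩⟩

/-- **The unguarded rate gives the crux** (the contentful reading of §5b). -/
theorem crux_of_linearTwoArmsRate'
    (hX : ∀ ε : ℝ, 0 < ε → ∃ K : ℕ, 2 ≤ K ∧ ∃ N : ℕ, ∀ n : ℕ, N ≤ n →
      (bondPercolation (zdGraph 3) (criticalProbI 3)).real
        {ω | ∃ x ∈ box 3 n, ∃ x' ∈ box 3 n,
          ∃ z ∈ innerBoundary (zdGraph 3) (box 3 (K * n)), ∃ z' ∈ innerBoundary (zdGraph 3) (box 3 (K * n)),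
            ω ∈ openConnIn ↑(box 3 (K * n)) x z ∧ ω ∈ openConnIn ↑(box 3 (K * n)) x' z' ∧
              ω ∉ openConnIn ↑(box 3 (K * n)) x x'} ≤ ε / K) :
    Summit.CriticalPhenomena.PercolationContinuityZ3.Theses.PercFiniteBoxLRO.RenormaliseFromLinearLRO :=
  crux_of_linearTwoArmsRate fun _ => hX

end Summit.CriticalPhenomena.PercolationContinuityZ3.Cruxes.RenormaliseFromLinearLRO.Birth

end
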